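import Summits.ResolutionOfSingularities.ResolutionOfSingularities.Theorems.FrobeniusClosingSteerWords02Stubs
import Summits.ResolutionOfSingularities.ResolutionOfSingularities.Theorems.FrobeniusClosingSteerWords03Phases
import Summits.ResolutionOfSingularities.ResolutionOfSingularities.Theorems.FrobeniusClosingSteerCore4GenExit
import Summits.ResolutionOfSingularities.ResolutionOfSingularities.Theorems.FrobeniusClosingSteerCore4RunTrichotomy
import Summits.ResolutionOfSingularities.ResolutionOfSingularities.Theorems.FrobeniusClosingSteerNotCoarseningArchSeq

/-!
# Crux `Steer` (stmt-ResolutionOfSingularities-16345), line `switching-dichotomy` — WORDS 05: the r16 (α) HEART «SS ∧ rank one ∧ defect» at `n = 4`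
(`archSeq_and_defect_of_not_hasProperCoarsening`, `NotCoarseningArchSeq`, `notCoarseningArchSeq`) and res-L0-w41-strat-1's §F
`ss-monomial-cycles` — the (α) heart re-cut (S0 `CompositeRankSS` = TYPE of the registered stub `stub_compositeRankSS`, which the
skeleton keeps proving; S1 `SSMonomialization`, S2 `MonomialStageTrichotomy`, S3 `EternalCyclesSS`, the cycle engine and the
compositions `concl_of_cycles` / `neverLogFinalSS_concl_of_cycles` / `eternalAlternationSSL_of_cycles` / `eternalStallPhaseSSL_of_cycles`),
with the discharged P1 leaf `genExit_holds` (r13, over the landed `…Core4GenExit`, p495493) which the compositions consume by name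
(HOIST of the registered skeleton r34 ff764575764c21bc, l.3536–3544, l.4331–4375 and l.4377–4653)

RULING 47b (no duplicate hoists): the skeleton's `exists_pow_lt_of_rankOne` (r34 l.4308–4326) is NOT hoisted — res-D-pv-007 AS
res-L0-w41-stub-5 landed the same statement as `…Theorems.SwitchingDichotomy.exists_pow_valuation_lt_of_rankOne`
(`Theorems/FrobeniusClosingSteerNotCoarseningArchSeq.lean`; gate `dedup.landed`), so the two proofs below that called it
(`archSeq_and_defect_of_not_hasProperCoarsening`, `notCoarseningArchSeq`) call the tree lemma instead — the ONLY non-verbatim bytes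
in this module (proof terms, not statements).

Holder res-L0-w41-lead-1 g5 on res-L0-w41-plan-1 RULING 47 (E1); see `…Words01Core` for the hoist protocol (bodies byte for byte;
`[cite: …]` / `[folklore]` tags on CLOSED `def … : Prop` words are written «(ref. …)» / «(folklore)» — GATE NOTE of `…Words02Stubs`;
cite keys inside `[cite:]` tags normalised to `references.bib` keys: arXiv:1505.06445 ↦ HeinzerEtAl2015, arXiv:1512.03848 ↦
HeinzerOlberdingToeniskoetter2017, Kuhlmann2010Defect ↦ Kuhlmann2010ArtinSchreier — as in `…Words03Phases`).
Nothing here is a statement of the manuscript [claim: Hironaka2017, status: under-review]. OURS (candidates / vocabulary; AI review is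
weaker than expert review).
-/

open Summit.ResolutionOfSingularities.ResolutionOfSingularities.Theses.FrobeniusClosing (IsolatedForcedTermination)
open Literature.AlgebraicGeometry.Resolution (IsAbhyankarPlace FGOver exists_ringKrullDim_eq_and_trdeg_eq
  trdeg_eq_trdeg_of_isFractionRing locAtCentre IsQuadraticTransformAlong SubringDominates IsRsopPart
  LocalUniformization3 RelLocalUniformization CossartPiltant2019General)
open Summit.ResolutionOfSingularities.ResolutionOfSingularities.Theorems.SteerRankThinness
  (HasProperCoarsening concl_of_hasProperCoarsening rankOne_of_not_hasProperCoarsening)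

set_option linter.dupNamespace false

namespace Summit.ResolutionOfSingularities.ResolutionOfSingularities.Theorems.SwitchingDichotomy.Words

/-! ## r13 — the discharged P1 leaf (consumed below by `neverLogFinalSS_concl_of_cycles`) -/

/-- **DISCHARGED (r13: lead res-L0-w41-lead-1 g3, `Theorems.SwitchingDichotomy.genExit`,
`Theorems/FrobeniusClosingSteerCore4GenExit.lean`) — P1 `GenExit`, the generator exit.**
[cite: HeinzerEtAl2015, Prop. 4.4] [folklore] -/
theorem genExit_holds : GenExit := by
  intro p hp n _ k K _ _ _ _ _ O A₀ h₀ t core R hR0 hRq M hM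
  obtain ⟨hfg, htp, hfr, hreg, -⟩ := core
  obtain ⟨s', ⟨hsp, ht⟩, hone⟩ := hM
  exact Summit.ResolutionOfSingularities.ResolutionOfSingularities.Theorems.SwitchingDichotomy.genExit p hp k K O
    A₀ h₀ t hfg htp hfr hreg R hR0 hRq M s' hsp ht hone

/-! ### r16 — the (α) heart at `n = 4` is SS ∧ RANK ONE ∧ DEFECT (kernel-visible for the strategists) -/

/-- **The heart at `n = 4`.** For a core datum that is STRONGLY SWITCHING along a valuation ring WITHOUT a proper
coarsening (the only case the r15 frontier stubs see at `n = 4`), the valuation has rank one, hence the datum is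
parameter-archimedean along the point sequence (`Theorems.SwitchingDichotomy.archSeq_of_arch`), hence — by the core
binder `¬ (StronglySwitching ∧ ArchSeq ∧ ¬ Defect)` — it has DEFECT. So the registered residuals
`stub_eternalStallPhaseSSL` / `stub_eternalAlternationSSL` at `n = 4` are statements about rank-one DEFECT extensions
`T ^ p = t ^ p` of degree `p` (Kuhlmann's defect case) along strongly switching point sequences. OURS.
[cite: HeinzerEtAl2015, Remark 2.4] [cite: Kuhlmann2010ArtinSchreier, §2] [folklore] -/
theorem archSeq_and_defect_of_not_hasProperCoarsening (p n : ℕ) (k K : Type) [Field k] [Field K] [Algebra k K]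
    (O : ValuationSubring K) (A₀ : Subalgebra k K) (h₀ : A₀.toSubring ≤ O.toSubring) (t : K)
    (core : CoreDatum p n k K O A₀ h₀ t) (hss : StronglySwitching O A₀) (hnc : ¬ HasProperCoarsening O) :
    ArchSeq O A₀ ∧ Defect O A₀ t p := by
  classical
  obtain ⟨-, -, -, hreg, -, -, hdim2, -, -, -, -, -, -, hnS⟩ := core
  -- the centre is non-zero, so `O ≠ ⊤`
  obtain ⟨a, haA, ha0, hva⟩ :=
    Summit.ResolutionOfSingularities.ResolutionOfSingularities.Theorems.SwitchingDichotomy.exists_mem_centre_of_not_ringKrullDim_le_two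
      O A₀ h₀ hdim2
  have hO : O ≠ ⊤ := by
    intro hO
    have hinv : O.valuation a⁻¹ ≤ 1 := (O.valuation_le_one_iff _).mpr (by rw [hO]; exact ValuationSubring.mem_top _)
    have h1 : O.valuation a * O.valuation a⁻¹ = 1 := by rw [← map_mul, mul_inv_cancel₀ ha0, map_one]
    have hlt : O.valuation a * O.valuation a⁻¹ < 1 * 1 :=
      mul_lt_mul_of_lt_of_le_of_nonneg_of_pos hva hinv zero_le zero_lt_one
    rw [h1, one_mul] at hlt
    exact lt_irrefl _ hlt
  have hr := rankOne_of_not_hasProperCoarsening O hO hnc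
  -- rank one ⇒ archimedean on fractions ⇒ parameter-archimedean along the point sequence (tree)
  have hArch : ArchSeq O A₀ :=
    Summit.ResolutionOfSingularities.ResolutionOfSingularities.Theorems.SwitchingDichotomy.archSeq_of_arch O A₀ h₀ hreg
      fun x y _ _ hy hx => _root_.Summit.ResolutionOfSingularities.ResolutionOfSingularities.Theorems.SwitchingDichotomy.exists_pow_valuation_lt_of_rankOne O hr hx hy
  refine ⟨hArch, ?_⟩
  by_contra hnd
  exact hnS ⟨hss, hArch, hnd⟩

/-- **(S) `NotCoarseningArchSeq`** (plan-1 g7's Sketch-R2-recut §5 statement, VERBATIM): along a valuation ring `O ≠ K`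
WITHOUT proper coarsening the parameter-archimedean property `ArchSeq O A₀` holds for every finitely generated base regular
at the centre. PROVED below in-skeleton (r17). (ref. HeinzerEtAl2015, Remark 2.4) (folklore) -/
def NotCoarseningArchSeq : Prop :=
  ∀ (k K : Type) [Field k] [Field K] [Algebra k K] (O : ValuationSubring K) (A₀ : Subalgebra k K)
    (h₀ : A₀.toSubring ≤ O.toSubring), O ≠ ⊤ → ¬ HasProperCoarsening O →
    IsRegularLocalRing (Localization.AtPrime
      (Ideal.comap (Subring.inclusion h₀) (IsLocalRing.maximalIdeal O))) →
    ArchSeq O A₀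

/-- **PROVED (r17): the archimedean bridge** — rank one (`rankOne_of_not_hasProperCoarsening`) ⇒ archimedean on elements
(`exists_pow_lt_of_rankOne`) ⇒ `ArchSeq` (`Theorems.SwitchingDichotomy.archSeq_of_arch`). [cite: HeinzerEtAl2015, Remark 2.4]
[folklore] -/
theorem notCoarseningArchSeq : NotCoarseningArchSeq := by
  intro k K _ _ _ O A₀ h₀ hO hnc hreg
  exact Summit.ResolutionOfSingularities.ResolutionOfSingularities.Theorems.SwitchingDichotomy.archSeq_of_arch O A₀ h₀
    hreg fun x y _ _ hy hx => _root_.Summit.ResolutionOfSingularities.ResolutionOfSingularities.Theorems.SwitchingDichotomy.exists_pow_valuation_lt_of_rankOne O (rankOne_of_not_hasProperCoarsening O hO hnc) hx hy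


/-! ## r21 — ALTERNATIVE DECOMPOSITION of the (α) heart: res-L0-w41-strat-1 g0's LINE `ss-monomial-cycles` §F
(`L/res-L0-w41-strat-1/line-ss-monomial-cycles.lean` c94e4ea68bbafa85, pasted VERBATIM minus its four `sorry` stubs and the
duplicate `genExit_holds`; NOTHING REGISTERED CHANGES — S0 `CompositeRankSS`, S1 `SSMonomialization`, S2 `MonomialStageTrichotomy`,
S3 `EternalCyclesSS` enter as named `Prop`s and HYPOTHESES of the kernel-checked `eternalStallPhaseSSL_of_cycles` /
`eternalAlternationSSL_of_cycles`; a landing of S1/S2 (dischargeable) would let the holder re-cut Φ3ᴸˢ+Φ4ᴸˢ to {S0, S3} within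
the cap). OURS; candidate, unreviewed (tri rows pending). -/
/-! ## §F (res-L0-w41-strat-1 g0, CRUX-STRATEGIST line `ss-monomial-cycles`) — the (α) heart re-cut:
STRONGLY-SWITCHING TORSORS RUN IN MONOMIAL CYCLES

OURS (candidate, unreviewed; an AI review is weaker than expert review). Lens `negation`: trying to BUILD
a strongly-switching datum whose torsor alternates for ever (an inhabitant of `EternalAlternationSSL`'s
hypotheses) forces a canonical form on every such datum. Under `StronglySwitching` with `O` of rank one
the quadratic sequence MONOMIALIZES every non-zero element of its members (Granja's criterion: the
sequence switches strongly iff the transform of every principal ideal becomes trivial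
[cite: HeinzerOlberdingToeniskoetter2017, Remark 3.2 and Remark 3.3]; the tree's `stub_rsopMonomialStep`
(`Theorems/FrobeniusClosingSteerRsopMonomialStep.lean`, HLOST Lemma 2.7) carries monomials forward;
`ArchSeq` from rank one by `archSeq_of_arch`). Hence at some member `S = R M` the radicand of a generator
`s` (`s ^ p ∈ S`, `t ∈ S[s]`) is `∏ z_l ^ m_l · u` in a regular system of parameters `z` of `S`:
EITHER some `m_l ≢ 0 (mod p)` — then `s ^ p` is `ToroidalAt`, which is exactly GIRAUD'S NORMAL FORM
`u = v ^ p + x ^ a`, `a ≢ 0 (p)` [Gir83 (dim 2), Cos87a (dim 3), as globalized in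
cite: arXiv:2405.05735, proof of Thm. 4.0.1 and App. A], i.e. the E2 disjunct of `LogFinalAt` — OR all
`m_l ≡ 0`: then `s ^ p = μ ^ p · u` with `μ = ∏ z_l ^ (m_l / p)` an rsop-monomial, `u` a unit, and
(residue field perfect) `u ≡ c ^ p (mod 𝔪_S)` for a unit `c`; the new generator `s₁ := s / μ - c` has
radicand `u - c ^ p ∈ 𝔪_S`: ORDER ONE gives `ExitAt`, order `≥ 2` starts the next cycle. So the
hypotheses "never log-final, never exit" of `EternalStallPhaseSSL` / `EternalAlternationSSL` force an
ETERNAL RUN OF p-DIVISIBLE SINGULAR CYCLES `s_j = μ_j (s_{j+1} + c_j)`, and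
`t = s_0 = c_0 μ_0 + c_1 μ_0 μ_1 + ⋯ + μ_0 ⋯ μ_j s_{j+1}` is the digit (pseudo-Cauchy) expansion of `t`
over `Frac A₀` which the DEFECT of `K / Frac A₀` at `v` predicts [cite: Kuhlmann2010ArtinSchreier, §2]. The
frontier statement `EternalCyclesSS` (S3) says: a datum carrying such an eternal run has a regular model.
It is WEAKER than idea-2's `SeqLogFinalSS` (which makes S3 vacuous) and, with the dischargeable S1/S2 and
the landed `genExit`, it implies BOTH (α)-heart stubs by name (`eternalStallPhaseSSL_of_cycles`,
`eternalAlternationSSL_of_cycles` below, kernel-checked). The composite-rank cases hidden in the r15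
targets at `n ≥ 5` are isolated as S0 (at `n = 4` they are excluded by the targets' own binder).

Transfer (lens 2, census): S3 = "Giraud–Cossart forme normale of `t ^ p` ALONG a strongly-switching
valuation, base dimension `n ≥ 4`"; dim 2 Giraud 1983, dim 3 Cossart 1987 (= the input of
Cossart–Piltant); the first non-transferring step is Cossart's control of the one-dimensional bad locus
(App. A.2 of arXiv:2405.05735: reduction to `dim Sing ≤ 1`), which in base dimension 4 becomes a surface;
the lever replacing it here is Granja's criterion (an SS valuation leaves every fixed subvariety).

Numbering: S0 `stub_compositeRankSS`, S1 `stub_ssMonomialization`, S2 `stub_monomialStageTrichotomy`,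
S3 `stub_eternalCyclesSS` (FRONTIER, the re-cut heart). -/

section Cycles

variable {k K : Type} [Field k] [Field K] [Algebra k K]

/-- `h ∈ K` is an rsop-MONOMIAL TIMES A UNIT of the local ring `S`: `h = ∏ z_l ^ m_l · u` with `z` part of
a regular system of parameters of `S` (`ToroidalAt` without the exponent condition; `s = 0` allowed, so
units qualify). [cite: HeinzerEtAl2015, Lemma 2.7] [folklore] -/
def MonomialAt (S : Subring K) [IsLocalRing S] (h : K) : Prop :=
  ∃ (s : ℕ) (z : Fin s → S), IsRsopPart z ∧ ∃ (m : Fin s → ℕ) (u : S), IsUnit u ∧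
    h = (∏ l, ((z l : S) : K) ^ m l) * (u : K)

/-- One MONOMIAL CYCLE STEP of the torsor of `t` at the member `S`: the generator `s` is replaced by
`s₁` with `s = μ * (s₁ + c)`, `μ` an rsop-monomial of `S` (the `p`-th root of the monomial part of the
radicand `s ^ p`), `c` a unit of `S` (a `p`-th root of the unit part modulo `𝔪_S`), the new radicand
`s₁ ^ p` in the centre of `O` on `S`; and `μ` is a NON-unit as soon as the old radicand was.
OURS. [folklore] -/
def CycleStepAt (O : ValuationSubring K) (S : Subring K) (p : ℕ) (t s s₁ μ c : K) : Prop :=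
  μ ∈ S ∧ c ∈ S ∧ (∃ (_ : IsLocalRing S), MonomialAt S μ) ∧ O.valuation c = 1 ∧
    s = μ * (s₁ + c) ∧ s₁ ≠ 0 ∧ GenAt S p t s₁ ∧ O.valuation (s₁ ^ p) < 1 ∧
    (O.valuation (s ^ p) < 1 → O.valuation μ < 1)

end Cycles

/-- **S0 `CompositeRankSS` (side debt, NOT new: it is inside the r15 targets, whose binder excludes
composite rank only at `n = 4`).** At transcendence degree `n ≥ 5` a strongly-switching core datum along
a valuation ring WITH a proper coarsening (rank `≥ 2`, the height-one-directed case of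
(ref. HeinzerEtAl2015, Discussion 4.2)) has a regular model, given torsor LU below `n`. At `n = 4` this
is the landed `concl_of_hasProperCoarsening` (p493665, via `CossartPiltant2019General`); at `n ≥ 5` the
induction hypothesis `TorsorLUZeroDimBelow p n` does not apply verbatim to the non-zero-dimensional
coarsening (perfect ground field), so this is typed debt of the same kind as every `n ≥ 5` clause.
Why it might fail: only by being as hard as LU below `n` for non-perfect ground fields. (folklore) -/
def CompositeRankSS : Prop :=
  ∀ p : ℕ, p.Prime → p ≠ 2 → ∀ n : ℕ, 4 ≤ n → TorsorLUZeroDimBelow p n →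
    ∀ (k K : Type) [Field k] [CharP k p] [PerfectField k] [Field K] [Algebra k K]
    (O : ValuationSubring K) (A₀ : Subalgebra k K) (h₀ : A₀.toSubring ≤ O.toSubring) (t : K),
    CoreDatum p n k K O A₀ h₀ t → StronglySwitching O A₀ → n ≠ 4 → HasProperCoarsening O →
    Concl O A₀ t

/-- **S1 `SSMonomialization` (dischargeable, size M).** Along a strongly-switching quadratic sequence of
a core datum with `O` of rank one (no proper coarsening), every non-zero element of a member `R M`
becomes an rsop-monomial times a unit in some later member `R M'`. Route: `O ≠ ⊤` and
`rankOne_of_not_hasProperCoarsening` give rank one, `archSeq_of_arch` a one-element rsop part `z` of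
some member with `v(z ^ a) < v(h)`; `z ^ a / h ∈ O ∩ Frac A₀` lies in some member by `StronglySwitching`;
`z` stays an rsop-monomial times a unit in all later members (`stub_rsopMonomialStep`, iterated); in the
regular (factorial) `R M'` a divisor of a monomial in prime parameters is a sub-monomial times a unit.
This is Granja's criterion. (ref. HeinzerOlberdingToeniskoetter2017, Remark 3.2) (ref. HeinzerEtAl2015, Lemma 2.7)
Why it might fail: only through a typing slip (it is a published equivalence in rank one). -/
def SSMonomialization : Prop :=
  ∀ p : ℕ, p.Prime → p ≠ 2 → ∀ n : ℕ, 4 ≤ n →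
    ∀ (k K : Type) [Field k] [CharP k p] [PerfectField k] [Field K] [Algebra k K]
    (O : ValuationSubring K) (A₀ : Subalgebra k K) (h₀ : A₀.toSubring ≤ O.toSubring) (t : K),
    CoreDatum p n k K O A₀ h₀ t → StronglySwitching O A₀ → ¬ HasProperCoarsening O →
    ∀ R : ℕ → Subring K, R 0 = locAtCentre A₀.toSubring O →
      (∀ i, IsQuadraticTransformAlong O (R i) (R (i + 1))) →
      ∀ (M : ℕ) (h : K), h ∈ R M → h ≠ 0 →
        ∃ M', M ≤ M' ∧ ∃ (_ : IsLocalRing (R M')), MonomialAt (R M') h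

/-- **S2 `MonomialStageTrichotomy` (dischargeable, size M; local algebra at ONE member).** If the radicand
`s ^ p` of a generator `s` of the torsor of `t` over the member `S = R M` is an rsop-monomial times a unit,
`s ^ p = ∏ z_l ^ m_l · u`, then: some `m_l ≢ 0 (mod p)` ⟹ `ToroidalAt p S (s ^ p)` with `s ∉ Frac A₀`
(else `t ∈ S[s] ⊆ Frac A₀`, contradicting the core datum's `t ^ p ≠ c ^ p`), i.e. `LogExitAt` (E2,
Giraud's normal form); all `m_l ≡ 0` ⟹ `s ^ p = μ ^ p u`, `μ = ∏ z_l ^ (m_l / p)`, and since the residue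
field of `S` is perfect (inside that of the zero-dimensional `O` over the perfect `k`) there is a unit `c`
with `u - c ^ p ∈ 𝔪_S`; with `s₁ = s / μ - c`: `u - c ^ p ∈ 𝔪_S ∖ 𝔪_S ^ 2` ⟹ `OrderOneGen S p s₁`, i.e.
`ExitAt`; otherwise `CycleStepAt O S p t s s₁ μ c` (`s₁ ≠ 0` because `t ∉ S`). Sources: the `p`-th power
cleaning of (ref. arXiv:1412.0868, §2) at a monomial radicand; (ref. arXiv:2405.05735, (4.0.1.j)).
Why it might fail: a slip in the side conditions (`s₁ ≠ 0`, unit/valuation dictionary on members). -/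
def MonomialStageTrichotomy : Prop :=
  ∀ p : ℕ, p.Prime → p ≠ 2 → ∀ n : ℕ, 4 ≤ n →
    ∀ (k K : Type) [Field k] [CharP k p] [PerfectField k] [Field K] [Algebra k K]
    (O : ValuationSubring K) (A₀ : Subalgebra k K) (h₀ : A₀.toSubring ≤ O.toSubring) (t : K),
    CoreDatum p n k K O A₀ h₀ t → StronglySwitching O A₀ → ¬ HasProperCoarsening O →
    ∀ R : ℕ → Subring K, R 0 = locAtCentre A₀.toSubring O →
      (∀ i, IsQuadraticTransformAlong O (R i) (R (i + 1))) →
      ∀ (M : ℕ) (s : K), GenAt (R M) p t s → (∃ (_ : IsLocalRing (R M)), MonomialAt (R M) (s ^ p)) →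
        LogExitAt (R M) p A₀ t ∨ ExitAt (R M) p t ∨ ∃ s₁ μ c : K, CycleStepAt O (R M) p t s s₁ μ c

/-- **S3 `EternalCyclesSS` — THE RE-CUT (α) HEART (FRONTIER; dimension-free for `n ≥ 4`).** A
strongly-switching rank-one core datum whose quadratic sequence is never log-final and never at an exit,
and which carries an ETERNAL RUN OF p-DIVISIBLE SINGULAR CYCLES — generators `s j` of the torsor of `t`
over members `R (Mj j)` (`Mj` monotone), radicands in the centre, linked by `s j = μ j * (s (j+1) + c j)`
with `μ j` a non-unit rsop-monomial and `c j` a unit of `R (Mj (j+1))` — has a regular model. Two attacks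
(line card): (A) NO SUCH RUN EXISTS (then S3 is vacuous and the SS core closes by S1+S2): each cycle
requires the centre to sit on the critical locus of the digit `u_j - c_j ^ p` AND all boundary exponents
of the next monomialization to be `≡ 0 (mod p)`; in base dimension 2 this is excluded by resolution of
the p-closed 1-foliation `ker d(t ^ p)` (ref. arXiv:2405.05735, Thm. 4.0.1) plus the core exclusions
(`¬ Discrete`, not Abhyankar: an SS valuation cannot follow an invariant curve); (B) CONSTRUCT the model
from the expansion `t = Σ_j c_j μ_0 ⋯ μ_j + μ_0 ⋯ μ_j s_{j+1}` (a pseudo-Cauchy sequence of the defect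
extension (ref. Kuhlmann2010ArtinSchreier, §2); dichotomy `Σ v(μ_j) = ∞` (then `t` lies in the completion of
`Frac A₀`) versus bounded). Strictly weaker than `SeqLogFinalSS` (r15 §idea-2), which makes it vacuous.
Why it might fail: only if torsor LU itself fails at an SS valuation of rank one — no inhabitant of the
hypotheses is on record (cheapest falsifier: the cycle census K4.1g of the line card). OURS. (folklore) -/
def EternalCyclesSS : Prop :=
  ∀ p : ℕ, p.Prime → p ≠ 2 → ∀ n : ℕ, 4 ≤ n → TorsorLUZeroDimBelow p n →
    ∀ (k K : Type) [Field k] [CharP k p] [PerfectField k] [Field K] [Algebra k K]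
    (O : ValuationSubring K) (A₀ : Subalgebra k K) (h₀ : A₀.toSubring ≤ O.toSubring) (t : K),
    CoreDatum p n k K O A₀ h₀ t → StronglySwitching O A₀ → ¬ HasProperCoarsening O →
    ∀ R : ℕ → Subring K, R 0 = locAtCentre A₀.toSubring O →
      (∀ i, IsQuadraticTransformAlong O (R i) (R (i + 1))) →
      (∀ M, ¬ LogExitAt (R M) p A₀ t) → (∀ M, ¬ ExitAt (R M) p t) →
      ∀ (Mj : ℕ → ℕ) (s μ c : ℕ → K), Monotone Mj →
        (∀ j, GenAt (R (Mj j)) p t (s j) ∧ s j ≠ 0 ∧ O.valuation (s j ^ p) < 1) →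
        (∀ j, μ j ∈ R (Mj (j + 1)) ∧ c j ∈ R (Mj (j + 1)) ∧
          (∃ (_ : IsLocalRing (R (Mj (j + 1)))), MonomialAt (R (Mj (j + 1))) (μ j)) ∧
          O.valuation (c j) = 1 ∧ O.valuation (μ j) < 1 ∧ s j = μ j * (s (j + 1) + c j)) →
        Concl O A₀ t

/-! ### §F compositions (kernel-checked; no `sorry` of their own) -/

section CycleEngine

variable {k K : Type} [Field k] [Field K] [Algebra k K]

/-- Generators persist along the sequence. [folklore] -/
theorem genAt_mono {S S' : Subring K} (hSS' : S ≤ S') {p : ℕ} {t s : K} (h : GenAt S p t s) :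
    GenAt S' p t s := by
  refine ⟨hSS' h.1, ?_⟩
  exact Subring.closure_mono (Set.insert_subset_insert fun x hx => hSS' hx) h.2

/-- `t` itself is a generator over `R 0 ⊇ A₀ ∋ t ^ p`. [folklore] -/
theorem genAt_self (O : ValuationSubring K) (A₀ : Subalgebra k K) {p : ℕ} {t : K} (htp : t ^ p ∈ A₀)
    (R : ℕ → Subring K) (hR0 : R 0 = locAtCentre A₀.toSubring O) : GenAt (R 0) p t t := by
  refine ⟨?_, Subring.subset_closure (Set.mem_insert t _)⟩
  rw [hR0]
  exact Literature.AlgebraicGeometry.Resolution.le_locAtCentre A₀.toSubring O htp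

/-- The radicand of a core datum is non-zero (`t ^ p ≠ c ^ p` with `c = 0`). [folklore] -/
theorem t_ne_zero_of_coreDatum {p n : ℕ} (hp : p.Prime) {O : ValuationSubring K} {A₀ : Subalgebra k K}
    {h₀ : A₀.toSubring ≤ O.toSubring} {t : K} (core : CoreDatum p n k K O A₀ h₀ t) : t ≠ 0 := by
  obtain ⟨-, htp, -, -, -, -, -, -, -, -, -, hc, -⟩ := core
  rintro rfl
  apply hc 0
  have h0 : (⟨(0 : K) ^ p, htp⟩ : A₀.toSubring) = 0 := by
    apply Subtype.ext
    simp [hp.ne_zero]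
  rw [h0, map_zero, zero_pow hp.ne_zero]

end CycleEngine

/-- **The cycle engine (kernel-checked).** S1 + S2 + S3 settle every strongly-switching rank-one core
datum whose sequence is never log-final and never at an exit: iterate (monomialize the radicand by S1,
apply the trichotomy S2 — both exit branches are excluded by hypothesis — and pass to the next cycle),
obtaining by recursion an eternal run of p-divisible singular cycles, which S3 settles. OURS. [folklore] -/
theorem concl_of_cycles (h1 : SSMonomialization) (h2 : MonomialStageTrichotomy) (h3 : EternalCyclesSS)
    {p : ℕ} (hp : p.Prime) (hp2 : p ≠ 2) {n : ℕ} (hn : 4 ≤ n) (hB : TorsorLUZeroDimBelow p n)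
    (k K : Type) [Field k] [CharP k p] [PerfectField k] [Field K] [Algebra k K]
    (O : ValuationSubring K) (A₀ : Subalgebra k K) (h₀ : A₀.toSubring ≤ O.toSubring) (t : K)
    (core : CoreDatum p n k K O A₀ h₀ t) (hss : StronglySwitching O A₀) (hr1 : ¬ HasProperCoarsening O)
    (R : ℕ → Subring K) (hR0 : R 0 = locAtCentre A₀.toSubring O)
    (hRq : ∀ i, IsQuadraticTransformAlong O (R i) (R (i + 1)))
    (hnl : ∀ M, ¬ LogExitAt (R M) p A₀ t) (hne : ∀ M, ¬ ExitAt (R M) p t) : Concl O A₀ t := by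
  classical
  have hmono : Monotone R := member_monotone O R hRq
  -- one full cycle: monomialize the radicand (S1), then the trichotomy (S2) with both exits excluded
  have step : ∀ (M : ℕ) (s : K), GenAt (R M) p t s → s ≠ 0 →
      ∃ (M' : ℕ) (s₁ μ c : K), M ≤ M' ∧ CycleStepAt O (R M') p t s s₁ μ c := by
    intro M s hg hs0
    obtain ⟨M', hMM', hloc, hmon⟩ :=
      h1 p hp hp2 n hn k K O A₀ h₀ t core hss hr1 R hR0 hRq M (s ^ p) hg.1 (pow_ne_zero _ hs0)
    rcases h2 p hp hp2 n hn k K O A₀ h₀ t core hss hr1 R hR0 hRq M' s (genAt_mono (hmono hMM') hg)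
        ⟨hloc, hmon⟩ with hl | hx | ⟨s₁, μ, c, hc⟩
    · exact absurd hl (hnl M')
    · exact absurd hx (hne M')
    · exact ⟨M', s₁, μ, c, hMM', hc⟩
  -- the states of the run: (stage, generator) with the generator non-zero
  let St := {x : ℕ × K // GenAt (R x.1) p t x.2 ∧ x.2 ≠ 0}
  have hex : ∀ x : St, ∃ (y : St) (μ c : K), x.1.1 ≤ y.1.1 ∧ CycleStepAt O (R y.1.1) p t x.1.2 y.1.2 μ c := by
    rintro ⟨⟨M, s⟩, hg, hs0⟩
    obtain ⟨M', s₁, μ, c, hle, hc⟩ := step M s hg hs0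
    exact ⟨⟨(M', s₁), hc.2.2.2.2.2.2.1, hc.2.2.2.2.2.1⟩, μ, c, hle, hc⟩
  choose nxt μf cf hle hcyc using hex
  have t0 : GenAt (R 0) p t t ∧ t ≠ 0 := by
    obtain ⟨htp, -⟩ := core.2
    exact ⟨genAt_self O A₀ htp R hR0, t_ne_zero_of_coreDatum hp core⟩
  let run : ℕ → St := fun j => Nat.rec (⟨(0, t), t0⟩ : St) (fun _ x => nxt x) j
  have hrun : ∀ j, run (j + 1) = nxt (run j) := fun j => rfl
  -- the eternal run handed to S3, shifted by one so that every `μ` is a non-unit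
  refine h3 p hp hp2 n hn hB k K O A₀ h₀ t core hss hr1 R hR0 hRq hnl hne
    (fun j => (run (j + 1)).1.1) (fun j => (run (j + 1)).1.2) (fun j => μf (run (j + 1)))
    (fun j => cf (run (j + 1))) ?_ ?_ ?_
  · refine monotone_nat_of_le_succ fun j => ?_
    show (run (j + 1)).1.1 ≤ (run (j + 1 + 1)).1.1
    rw [hrun (j + 1)]
    exact hle (run (j + 1))
  · intro j
    refine ⟨(run (j + 1)).2.1, (run (j + 1)).2.2, ?_⟩
    have h := hcyc (run j)
    rw [← hrun j] at h
    exact h.2.2.2.2.2.2.2.1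
  · intro j
    have h := hcyc (run (j + 1))
    have h' := hcyc (run j)
    rw [← hrun (j + 1)] at h
    rw [← hrun j] at h'
    refine ⟨h.1, h.2.1, h.2.2.1, h.2.2.2.1, ?_, h.2.2.2.2.1⟩
    exact h.2.2.2.2.2.2.2.2 h'.2.2.2.2.2.2.2.1

/-- **The never-log-final strongly-switching core from the cycle stubs (kernel-checked).** Composite rank
(only possible at `n ≥ 5` under the targets' binder) goes to S0; an exit at ANY member gives the model by
the LANDED `genExit` (p495493); otherwise the cycle engine applies. For the holder: together with r15's
dischargeable `stub_logExit : LogExit` this is `CoreDatum ∧ StronglySwitching ∧ (n = 4 → rank one) ⇒ Concl`,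
so S0–S3 + `LogExit` also cover the strongly-switching share of R2 `stub_core4EternalNonIsolated`.
OURS. [folklore] -/
theorem neverLogFinalSS_concl_of_cycles (h0 : CompositeRankSS) (h1 : SSMonomialization)
    (h2 : MonomialStageTrichotomy) (h3 : EternalCyclesSS) :
    ∀ p : ℕ, p.Prime → p ≠ 2 → ∀ n : ℕ, 4 ≤ n → TorsorLUZeroDimBelow p n →
    ∀ (k K : Type) [Field k] [CharP k p] [PerfectField k] [Field K] [Algebra k K]
    (O : ValuationSubring K) (A₀ : Subalgebra k K) (h₀ : A₀.toSubring ≤ O.toSubring) (t : K),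
    CoreDatum p n k K O A₀ h₀ t → StronglySwitching O A₀ → (n = 4 → ¬ HasProperCoarsening O) →
    ∀ R : ℕ → Subring K, R 0 = locAtCentre A₀.toSubring O →
      (∀ i, IsQuadraticTransformAlong O (R i) (R (i + 1))) →
      (∀ M, ¬ LogExitAt (R M) p A₀ t) → Concl O A₀ t := by
  intro p hp hp2 n hn hB k K _ _ _ _ _ O A₀ h₀ t core hss hnc R hR0 hRq hnl
  by_cases hr : HasProperCoarsening O
  · exact h0 p hp hp2 n hn hB k K O A₀ h₀ t core hss (fun h4 => hnc h4 hr) hr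
  · by_cases hx : ∃ M, ExitAt (R M) p t
    · obtain ⟨M, hM⟩ := hx
      exact genExit_holds p hp n hn k K O A₀ h₀ t core R hR0 hRq M hM
    · push Not at hx
      exact concl_of_cycles h1 h2 h3 hp hp2 hn hB k K O A₀ h₀ t core hss hr R hR0 hRq hnl hx

/-- **Φ4ᴸˢ from the cycle stubs (kernel-checked; concludes `EternalAlternationSSL` BY NAME).** The
alternation hypotheses beyond "never log-final" are not used. OURS. [folklore] -/
theorem eternalAlternationSSL_of_cycles (h0 : CompositeRankSS) (h1 : SSMonomialization)
    (h2 : MonomialStageTrichotomy) (h3 : EternalCyclesSS) : EternalAlternationSSL := by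
  intro p hp hp2 n hn hB k K _ _ _ _ _ O A₀ h₀ t core hss hnc R hR0 hRq hnl _ _ _
  exact neverLogFinalSS_concl_of_cycles h0 h1 h2 h3 p hp hp2 n hn hB k K O A₀ h₀ t core hss hnc R hR0 hRq hnl

/-- **Φ3ᴸˢ from the cycle stubs (kernel-checked; concludes `EternalStallPhaseSSL` BY NAME).** The stall
hypothesis is not used. OURS. [folklore] -/
theorem eternalStallPhaseSSL_of_cycles (h0 : CompositeRankSS) (h1 : SSMonomialization)
    (h2 : MonomialStageTrichotomy) (h3 : EternalCyclesSS) : EternalStallPhaseSSL := by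
  intro p hp hp2 n hn hB k K _ _ _ _ _ O A₀ h₀ t core hss hnc R hR0 hRq hnl _
  exact neverLogFinalSS_concl_of_cycles h0 h1 h2 h3 p hp hp2 n hn hB k K O A₀ h₀ t core hss hnc R hR0 hRq hnl

end Summit.ResolutionOfSingularities.ResolutionOfSingularities.Theorems.SwitchingDichotomy.Words
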